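import Literature.MathematicalPhysics.QuantumFieldTheory.QCDPhaseQuenchedReweighting
import Summits.QuantumFields.QCD.Theorems.SpectralDefectExtinctionWindowExtinctionSpreadTorusBoxes
import Summits.QuantumFields.QCD.Theorems.SpectralDefectExtinctionWindowExtinctionSpreadR3Pi
import Summits.QuantumFields.QCD.Theorems.SpectralDefectExtinctionWindowExtinctionSpreadR3Fiber
import Mathlib.MeasureTheory.Integral.Marginal

/-!
# The fibre over the contents of a set of cores

Helper for stub `stub_spreadFromPartsR3` (S6′, reshape r3) of line `free-volume-heavy-witness`
(crux `Summit.QuantumFields.QCD.Theses.SpectralDefectExtinction.WindowExtinction`,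
item stmt-QuantumFields-8964).  Tree vocabulary only (`GaugeConfig`, `box`, `Torus.proj`,
`haarProbability`).

`N` pairwise `(2R+1+D)`-separated cores `cs i + {-R,…,R}⁴` sit in the four-torus of side `n ≥ 2R+1`.
Freeze a gauge field `x` off the links of the cores of `S₀ ⊆ Fin N` and refill those links (`y`, product
Haar).  `spreadR3_core_fiber`: for a measurable log-weight `φ` on gauge fields with one-core oscillation
`≤ B'` and two-core mixed differences `≤ γ`, two disjoint measurable template classes `Tp`, `Tm` of
positive Haar measure, and a measurable integer statistic `X` that increases by at least one under every
`Tm → Tp` swap of the content of one core (any environment), the part of the fibre weight where all cores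
of `S₀` are active (content in `Tp ∪ Tm`) and `X = j` is at most `e^{2|S₀|²γ} C/√(|S₀|+1)` times the part
where all cores of `S₀` are active — GIVEN the fibre anti-concentration theorem (stub S4″, hypothesis)
and the weighted antichain bound with constant `C` at the floor `ε ≤ e^{-2B'} min(Haar Tp, Haar Tm)`.

Proof: label the links of the cores of `S₀` by `↥S₀ × (box site × direction)` (a bijection: boxes embed
for `2R+1 ≤ n` and separated boxes have disjoint images, landed `spread_proj_add_injective` /
`spread_proj_add_ne`), transport the fibre Haar measure to the product of the template Haar measures
(`spreadR3_lintegral_relabel`), and apply the abstract fibre bound `spreadR3_fiber_atom_le` to the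
composite of `φ`, `X` with the refill map; its hypotheses are the one-core and two-core hypotheses read through
the refill map (a refill of core `i` changes only the links of core `i`).
-/

noncomputable section

namespace Summit.QuantumFields.QCD.Cruxes.WindowExtinction.FreeVolumeHeavyWitness

open MeasureTheory Set Function
open Literature.MathematicalPhysics.QuantumLattice Literature.MathematicalPhysics.QuantumFieldTheory
  Literature.Probability.LatticeModels
open scoped ENNReal BigOperators Classical

/-- **Locality of the contents.** The content of a core outside `S₀` does not see a refill of the
links of the cores of `S₀` (separated cores have disjoint images, landed `spread_proj_add_ne`). -/
theorem spreadR3_core_locality :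
    ∀ {n : ℕ} [NeZero n] {R D N : ℕ} (cs : Fin N → (Fin 4 → ℤ)),
    (∀ i j, i ≠ j → ∀ q : Fin 4 → ℤ, ∃ k : Fin 4,
      ((2 * R + 1 + D : ℕ) : ℤ) ≤ |cs i k - cs j k - q k * n|) →
    ∀ (S₀ : Finset (Fin N)) (i : Fin N), i ∉ S₀ → ∀ (x : GaugeConfig 4 n SU3)
      (y : ↥(Finset.univ.filter fun e : Edge 4 n =>
        ∃ i ∈ S₀, ∃ y : ↥(box 4 R), Torus.proj n (cs i + (y : Fin 4 → ℤ)) = e.1) → SU3),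
      (fun yi : ↥(box 4 R) × Fin 4 =>
        updateFinset x (Finset.univ.filter fun e : Edge 4 n =>
          ∃ i ∈ S₀, ∃ y : ↥(box 4 R), Torus.proj n (cs i + (y : Fin 4 → ℤ)) = e.1) y
          (Torus.proj n (cs i + (yi.1 : Fin 4 → ℤ)), yi.2)) =
      fun yi : ↥(box 4 R) × Fin 4 => x (Torus.proj n (cs i + (yi.1 : Fin 4 → ℤ)), yi.2) := by
  intro n _ R D N cs hsep S₀ i hi x y
  funext yi
  have hnot : (Torus.proj n (cs i + (yi.1 : Fin 4 → ℤ)), yi.2) ∉ (Finset.univ.filter fun e : Edge 4 n =>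
      ∃ i ∈ S₀, ∃ y : ↥(box 4 R), Torus.proj n (cs i + (y : Fin 4 → ℤ)) = e.1) := by
    intro hmem
    simp only [Finset.mem_filter, Finset.mem_univ, true_and] at hmem
    obtain ⟨i', hi', y', hy'⟩ := hmem
    have hii : i' ≠ i := fun h => hi (h ▸ hi')
    exact spread_proj_add_ne (hsep i' i hii) y'.2 yi.1.2 hy'
  simp only [updateFinset, dif_neg hnot]

/-- **The fibre over the contents of a set of cores** (see the module docstring). -/
theorem spreadR3_core_fiber :
    (∀ {I T : Type} [Fintype I] [DecidableEq I] [MeasurableSpace T]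
      (ν : Measure T) [IsProbabilityMeasure ν] {Tp Tm : Set T},
      MeasurableSet Tp → MeasurableSet Tm → Disjoint Tp Tm → ν Tp ≠ 0 →
      ∀ {ε C : ℝ},
      (∀ (N : ℕ) (p : Fin N → ℝ), (∀ i, ε ≤ p i ∧ p i ≤ 1 - ε) →
        ∀ 𝒜 : Finset (Fin N → Bool), (∀ s ∈ 𝒜, ∀ s' ∈ 𝒜, (∀ i, s i ≤ s' i) → s = s') →
          ∑ s ∈ 𝒜, ∏ i, (if s i then p i else 1 - p i) ≤ C / Real.sqrt (N + 1)) →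
      ∀ {φ : (I → T) → ℝ}, Measurable φ → ∀ {a τ B : ℝ} {b : I → T → ℝ},
      (∀ i, Measurable (b i)) →
      (∀ t : I → T, (∀ i, t i ∈ Tp ∪ Tm) → |φ t - a - ∑ i, b i (t i)| ≤ τ) →
      (∀ i u u', u ∈ Tp ∪ Tm → u' ∈ Tp ∪ Tm → b i u ≤ b i u' + B) →
      (∀ i, ε * ∫ u in Tp ∪ Tm, Real.exp (b i u) ∂ν ≤ ∫ u in Tp, Real.exp (b i u) ∂ν ∧
        ∫ u in Tp, Real.exp (b i u) ∂ν ≤ (1 - ε) * ∫ u in Tp ∪ Tm, Real.exp (b i u) ∂ν) →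
      ∀ {X : (I → T) → ℤ}, Measurable X → ∀ (S' : Finset I),
      (∀ t : I → T, (∀ i, t i ∈ Tp ∪ Tm) → ∀ i ∈ S', ∀ u ∈ Tp, t i ∈ Tm →
        X t + 1 ≤ X (Function.update t i u)) →
      ∀ (j : ℤ),
      ∫⁻ t, (Set.pi Set.univ fun _ : I => Tp ∪ Tm).indicator
          (fun t => if X t = j then ENNReal.ofReal (Real.exp (φ t)) else 0) t
          ∂Measure.pi (fun _ : I => ν) ≤
        ENNReal.ofReal (Real.exp (2 * τ) * C / Real.sqrt (S'.card + 1)) *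
          ∫⁻ t, (Set.pi Set.univ fun _ : I => Tp ∪ Tm).indicator
            (fun t => ENNReal.ofReal (Real.exp (φ t))) t ∂Measure.pi (fun _ : I => ν)) →
    ∀ {n : ℕ} [NeZero n] {R D N : ℕ}, 2 * R + 1 ≤ n → ∀ (cs : Fin N → (Fin 4 → ℤ)),
    (∀ i j, i ≠ j → ∀ q : Fin 4 → ℤ, ∃ k : Fin 4,
      ((2 * R + 1 + D : ℕ) : ℤ) ≤ |cs i k - cs j k - q k * n|) →
    ∀ {Tp Tm : Set ((↥(box 4 R) × Fin 4) → SU3)}, MeasurableSet Tp → MeasurableSet Tm →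
    Disjoint Tp Tm →
    (Measure.pi fun _ : ↥(box 4 R) × Fin 4 => haarProbability SU3) Tp ≠ 0 →
    ∀ {ε C : ℝ},
    (∀ (N : ℕ) (p : Fin N → ℝ), (∀ i, ε ≤ p i ∧ p i ≤ 1 - ε) →
      ∀ 𝒜 : Finset (Fin N → Bool), (∀ s ∈ 𝒜, ∀ s' ∈ 𝒜, (∀ i, s i ≤ s' i) → s = s') →
        ∑ s ∈ 𝒜, ∏ i, (if s i then p i else 1 - p i) ≤ C / Real.sqrt (N + 1)) →
    ∀ {φ : GaugeConfig 4 n SU3 → ℝ}, Measurable φ → ∀ {γ B' : ℝ}, 0 ≤ γ →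
    ε ≤ Real.exp (-2 * B') *
      min ((Measure.pi fun _ : ↥(box 4 R) × Fin 4 => haarProbability SU3) Tp).toReal
        ((Measure.pi fun _ : ↥(box 4 R) × Fin 4 => haarProbability SU3) Tm).toReal →
    (∀ (i : Fin N) (U U' : GaugeConfig 4 n SU3),
      (∀ e, (¬ ∃ y : ↥(box 4 R), Torus.proj n (cs i + (y : Fin 4 → ℤ)) = e.1) → U' e = U e) →
      φ U' ≤ φ U + B') →
    (∀ (i j : Fin N), i ≠ j → ∀ (U U₁ U₂ U₁₂ : GaugeConfig 4 n SU3),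
      (∀ e, (¬ ∃ y : ↥(box 4 R), Torus.proj n (cs i + (y : Fin 4 → ℤ)) = e.1) → U₁ e = U e) →
      (∀ e, (¬ ∃ y : ↥(box 4 R), Torus.proj n (cs j + (y : Fin 4 → ℤ)) = e.1) → U₂ e = U e) →
      (∀ e, (∃ y : ↥(box 4 R), Torus.proj n (cs i + (y : Fin 4 → ℤ)) = e.1) → U₁₂ e = U₁ e) →
      (∀ e, (¬ ∃ y : ↥(box 4 R), Torus.proj n (cs i + (y : Fin 4 → ℤ)) = e.1) → U₁₂ e = U₂ e) →
      |φ U₁₂ - φ U₁ - φ U₂ + φ U| ≤ γ) →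
    ∀ {X : GaugeConfig 4 n SU3 → ℤ}, Measurable X →
    (∀ (i : Fin N) (U U' : GaugeConfig 4 n SU3),
      (∀ e, (¬ ∃ y : ↥(box 4 R), Torus.proj n (cs i + (y : Fin 4 → ℤ)) = e.1) → U' e = U e) →
      (fun yi : ↥(box 4 R) × Fin 4 => U (Torus.proj n (cs i + (yi.1 : Fin 4 → ℤ)), yi.2)) ∈ Tm →
      (fun yi : ↥(box 4 R) × Fin 4 => U' (Torus.proj n (cs i + (yi.1 : Fin 4 → ℤ)), yi.2)) ∈ Tp →
      X U + 1 ≤ X U') →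
    ∀ (j : ℤ) (S₀ : Finset (Fin N)) (x : GaugeConfig 4 n SU3),
    ∫⁻ y, (if (∀ i ∈ S₀, (fun yi : ↥(box 4 R) × Fin 4 =>
          updateFinset x (Finset.univ.filter fun e : Edge 4 n =>
            ∃ i ∈ S₀, ∃ y : ↥(box 4 R), Torus.proj n (cs i + (y : Fin 4 → ℤ)) = e.1) y
            (Torus.proj n (cs i + (yi.1 : Fin 4 → ℤ)), yi.2)) ∈ Tp ∪ Tm) ∧
          X (updateFinset x (Finset.univ.filter fun e : Edge 4 n =>
            ∃ i ∈ S₀, ∃ y : ↥(box 4 R), Torus.proj n (cs i + (y : Fin 4 → ℤ)) = e.1) y) = j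
        then ENNReal.ofReal (Real.exp (φ (updateFinset x (Finset.univ.filter fun e : Edge 4 n =>
            ∃ i ∈ S₀, ∃ y : ↥(box 4 R), Torus.proj n (cs i + (y : Fin 4 → ℤ)) = e.1) y))) else 0)
        ∂(Measure.pi fun _ : ↥(Finset.univ.filter fun e : Edge 4 n =>
            ∃ i ∈ S₀, ∃ y : ↥(box 4 R), Torus.proj n (cs i + (y : Fin 4 → ℤ)) = e.1) =>
          haarProbability SU3) ≤
      ENNReal.ofReal (Real.exp (2 * ((S₀.card : ℝ) ^ 2 * γ)) * C / Real.sqrt (S₀.card + 1)) *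
        ∫⁻ y, (if (∀ i ∈ S₀, (fun yi : ↥(box 4 R) × Fin 4 =>
            updateFinset x (Finset.univ.filter fun e : Edge 4 n =>
              ∃ i ∈ S₀, ∃ y : ↥(box 4 R), Torus.proj n (cs i + (y : Fin 4 → ℤ)) = e.1) y
              (Torus.proj n (cs i + (yi.1 : Fin 4 → ℤ)), yi.2)) ∈ Tp ∪ Tm)
          then ENNReal.ofReal (Real.exp (φ (updateFinset x (Finset.univ.filter fun e : Edge 4 n =>
              ∃ i ∈ S₀, ∃ y : ↥(box 4 R), Torus.proj n (cs i + (y : Fin 4 → ℤ)) = e.1) y))) else 0)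
          ∂(Measure.pi fun _ : ↥(Finset.univ.filter fun e : Edge 4 n =>
              ∃ i ∈ S₀, ∃ y : ↥(box 4 R), Torus.proj n (cs i + (y : Fin 4 → ℤ)) = e.1) =>
            haarProbability SU3) := by
  intro hFAM n _ R D N hRn cs hsep Tp Tm hTp hTm hdisj hTp0 ε C hAC φ hφm γ B' hγ0 hε hosc hmix X hXm
    hmono j S₀ x
  -- the links of the cores of `S₀` and their labelling by `↥S₀ × (box site × direction)`
  set E : Finset (Edge 4 n) := Finset.univ.filter fun e : Edge 4 n =>
    ∃ i ∈ S₀, ∃ y : ↥(box 4 R), Torus.proj n (cs i + (y : Fin 4 → ℤ)) = e.1 with hE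
  have hmemE : ∀ e, e ∈ E ↔ ∃ i ∈ S₀, ∃ y : ↥(box 4 R), Torus.proj n (cs i + (y : Fin 4 → ℤ)) = e.1 :=
    fun e => by simp only [hE, Finset.mem_filter, Finset.mem_univ, true_and]
  set emb : ↥S₀ × (↥(box 4 R) × Fin 4) → Edge 4 n :=
    fun p => (Torus.proj n (cs p.1 + (p.2.1 : Fin 4 → ℤ)), p.2.2) with hemb
  have hembE : ∀ p, emb p ∈ E := fun p => (hmemE _).2 ⟨p.1, p.1.2, p.2.1, rfl⟩
  have hinj : Function.Injective emb := by
    rintro ⟨i, ⟨y, μ⟩⟩ ⟨i', ⟨y', μ'⟩⟩ h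
    simp only [hemb, Prod.mk.injEq] at h
    obtain ⟨h1, h2⟩ := h
    by_cases hii : (i : Fin N) = i'
    · have hi : i = i' := Subtype.ext hii
      subst hi
      have hy : y = y' := Subtype.ext (spread_proj_add_injective hRn (cs i) y.2 y'.2 h1)
      subst hy; subst h2; rfl
    · exact absurd h1 (spread_proj_add_ne (hsep i i' hii) y.2 y'.2)
  have hbij : Function.Bijective fun p => (⟨emb p, hembE p⟩ : ↥E) := by
    refine ⟨fun p p' h => hinj (congrArg Subtype.val h), ?_⟩
    rintro ⟨e, he⟩
    obtain ⟨i, hi, y, hy⟩ := (hmemE e).1 he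
    exact ⟨(⟨i, hi⟩, (y, e.2)), Subtype.ext (Prod.ext hy rfl)⟩
  set σ : ↥S₀ × (↥(box 4 R) × Fin 4) ≃ ↥E := Equiv.ofBijective _ hbij with hσ
  have hσsymm : ∀ p, σ.symm ⟨emb p, hembE p⟩ = p := fun p => (Equiv.symm_apply_eq σ).2 rfl
  have hσval : ∀ e : ↥E, emb (σ.symm e) = e.1 := fun e =>
    congrArg Subtype.val (σ.apply_symm_apply e)
  -- the refill map
  set Θ : (↥S₀ → (↥(box 4 R) × Fin 4) → SU3) → (↥E → SU3) :=
    fun t e => t (σ.symm e).1 (σ.symm e).2 with hΘ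
  set Ψ : (↥S₀ → (↥(box 4 R) × Fin 4) → SU3) → GaugeConfig 4 n SU3 :=
    fun t => updateFinset x E (Θ t) with hΨ
  have hΘm : Measurable Θ :=
    measurable_pi_lambda _ fun e => (measurable_pi_apply _).comp (measurable_pi_apply _)
  have hΨm : Measurable Ψ := measurable_updateFinset.comp hΘm
  -- (Q1) the content of core `i ∈ S₀` of the refilled field is `t i`
  have hκΨ : ∀ (t : ↥S₀ → (↥(box 4 R) × Fin 4) → SU3) (i : ↥S₀),
      (fun yi : ↥(box 4 R) × Fin 4 => Ψ t (Torus.proj n (cs i + (yi.1 : Fin 4 → ℤ)), yi.2)) = t i := by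
    intro t i
    funext yi
    have h1 : Ψ t (emb (i, yi)) = Θ t ⟨emb (i, yi), hembE (i, yi)⟩ := by
      simp only [hΨ, updateFinset, dif_pos (hembE (i, yi))]
    have h2 : Θ t ⟨emb (i, yi), hembE (i, yi)⟩ = t i yi := by
      simp only [hΘ, hσsymm (i, yi)]
    exact h1.trans h2
  -- (Q3) a refill of core `i` changes only the links of core `i`
  have hagree : ∀ (t : ↥S₀ → (↥(box 4 R) × Fin 4) → SU3) (i : ↥S₀) (u : (↥(box 4 R) × Fin 4) → SU3)
      (e : Edge 4 n), (¬ ∃ y : ↥(box 4 R), Torus.proj n (cs i + (y : Fin 4 → ℤ)) = e.1) →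
      Ψ (Function.update t i u) e = Ψ t e := by
    intro t i u e he
    by_cases heE : e ∈ E
    · simp only [hΨ, updateFinset, dif_pos heE, hΘ]
      have hne : (σ.symm ⟨e, heE⟩).1 ≠ i := by
        intro hi
        apply he
        refine ⟨(σ.symm ⟨e, heE⟩).2.1, ?_⟩
        have hval := hσval ⟨e, heE⟩
        rw [← hi]
        exact congrArg Prod.fst hval
      rw [Function.update_of_ne hne]
    · simp only [hΨ, updateFinset, dif_neg heE]
  -- the hypotheses of the abstract fibre bound for `φ ∘ Ψ`, `X ∘ Ψ`
  have hmixΨ : ∀ (s : ↥S₀ → (↥(box 4 R) × Fin 4) → SU3) (i i' : ↥S₀), i ≠ i' →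
      ∀ (u v : (↥(box 4 R) × Fin 4) → SU3),
      |φ (Ψ (Function.update (Function.update s i u) i' v)) - φ (Ψ (Function.update s i u))
        - φ (Ψ (Function.update s i' v)) + φ (Ψ s)| ≤ γ := by
    intro s i i' hii' u v
    have hii : (i : Fin N) ≠ i' := fun h => hii' (Subtype.ext h)
    refine hmix i i' hii (Ψ s) (Ψ (Function.update s i u)) (Ψ (Function.update s i' v))
      (Ψ (Function.update (Function.update s i u) i' v)) (fun e he => hagree s i u e he)
      (fun e he => hagree s i' v e he) (fun e he => ?_) (fun e he => ?_)
    · -- on the links of core `i`: not links of core `i'`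
      obtain ⟨y, hy⟩ := he
      refine hagree (Function.update s i u) i' v e fun ⟨y', hy'⟩ => ?_
      exact spread_proj_add_ne (hsep i i' hii) y.2 y'.2 (hy.trans hy'.symm)
    · rw [Function.update_comm hii']
      exact hagree (Function.update s i' v) i u e he
  have hoscΨ : ∀ (s : ↥S₀ → (↥(box 4 R) × Fin 4) → SU3) (i : ↥S₀) (u u' : (↥(box 4 R) × Fin 4) → SU3),
      φ (Ψ (Function.update s i u)) ≤ φ (Ψ (Function.update s i u')) + B' := by
    intro s i u u'
    refine hosc i (Ψ (Function.update s i u')) (Ψ (Function.update s i u)) fun e he => ?_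
    rw [hagree s i u e he, hagree s i u' e he]
  have hmonoΨ : ∀ t : ↥S₀ → (↥(box 4 R) × Fin 4) → SU3, (∀ i, t i ∈ Tp ∪ Tm) →
      ∀ (i : ↥S₀), ∀ u ∈ Tp, t i ∈ Tm → X (Ψ t) + 1 ≤ X (Ψ (Function.update t i u)) := by
    intro t _ i u hu hti
    refine hmono i (Ψ t) (Ψ (Function.update t i u)) (fun e he => hagree t i u e he) ?_ ?_
    · rw [hκΨ t i]; exact hti
    · rw [hκΨ (Function.update t i u) i, Function.update_self]; exact hu
  -- the abstract fibre bound
  have key := spreadR3_fiber_atom_le hFAM (Measure.pi fun _ : ↥(box 4 R) × Fin 4 => haarProbability SU3)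
    hTp hTm hdisj hTp0 hAC (hφm.comp hΨm) hγ0 hmixΨ hoscΨ hε (hXm.comp hΨm) hmonoΨ j
  rw [Fintype.card_coe] at key
  -- transport to the fibre over the links
  have hact : ∀ t : ↥S₀ → (↥(box 4 R) × Fin 4) → SU3,
      (∀ i ∈ S₀, (fun yi : ↥(box 4 R) × Fin 4 =>
        Ψ t (Torus.proj n (cs i + (yi.1 : Fin 4 → ℤ)), yi.2)) ∈ Tp ∪ Tm) ↔
      t ∈ Set.pi Set.univ (fun _ : ↥S₀ => Tp ∪ Tm) := by
    intro t
    rw [Set.mem_univ_pi]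
    constructor
    · intro h i
      have := h i i.2
      rwa [hκΨ t i] at this
    · intro h i hi
      have := h ⟨i, hi⟩
      rwa [← hκΨ t ⟨i, hi⟩] at this
  have hL : ∀ t : ↥S₀ → (↥(box 4 R) × Fin 4) → SU3,
      (if (∀ i ∈ S₀, (fun yi : ↥(box 4 R) × Fin 4 =>
          Ψ t (Torus.proj n (cs i + (yi.1 : Fin 4 → ℤ)), yi.2)) ∈ Tp ∪ Tm) ∧ X (Ψ t) = j
        then ENNReal.ofReal (Real.exp (φ (Ψ t))) else 0) =
      (Set.pi Set.univ fun _ : ↥S₀ => Tp ∪ Tm).indicator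
        (fun t => if (X ∘ Ψ) t = j then ENNReal.ofReal (Real.exp ((φ ∘ Ψ) t)) else 0) t := by
    intro t
    by_cases ht : t ∈ Set.pi Set.univ (fun _ : ↥S₀ => Tp ∪ Tm)
    · rw [Set.indicator_of_mem ht]
      have ht' := (hact t).2 ht
      by_cases hj : X (Ψ t) = j
      · rw [if_pos ⟨ht', hj⟩]
        simp only [Function.comp_apply]
        rw [if_pos hj]
      · rw [if_neg (fun h => hj h.2)]
        simp only [Function.comp_apply]
        rw [if_neg hj]
    · rw [Set.indicator_of_notMem ht, if_neg]
      exact fun h => ht ((hact t).1 h.1)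
  have hR : ∀ t : ↥S₀ → (↥(box 4 R) × Fin 4) → SU3,
      (if (∀ i ∈ S₀, (fun yi : ↥(box 4 R) × Fin 4 =>
          Ψ t (Torus.proj n (cs i + (yi.1 : Fin 4 → ℤ)), yi.2)) ∈ Tp ∪ Tm)
        then ENNReal.ofReal (Real.exp (φ (Ψ t))) else 0) =
      (Set.pi Set.univ fun _ : ↥S₀ => Tp ∪ Tm).indicator
        (fun t => ENNReal.ofReal (Real.exp ((φ ∘ Ψ) t))) t := by
    intro t
    by_cases ht : t ∈ Set.pi Set.univ (fun _ : ↥S₀ => Tp ∪ Tm)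
    · rw [Set.indicator_of_mem ht, if_pos ((hact t).2 ht)]
      rfl
    · rw [Set.indicator_of_notMem ht, if_neg (fun h => ht ((hact t).1 h))]
  rw [spreadR3_lintegral_relabel (haarProbability SU3) E σ,
    spreadR3_lintegral_relabel (haarProbability SU3) E σ]
  calc _ = ∫⁻ t, (Set.pi Set.univ fun _ : ↥S₀ => Tp ∪ Tm).indicator
          (fun t => if (X ∘ Ψ) t = j then ENNReal.ofReal (Real.exp ((φ ∘ Ψ) t)) else 0) t
          ∂(Measure.pi fun _ : ↥S₀ => Measure.pi fun _ : ↥(box 4 R) × Fin 4 => haarProbability SU3) :=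
        lintegral_congr hL
    _ ≤ _ := key
    _ = _ := by rw [lintegral_congr hR]

end Summit.QuantumFields.QCD.Cruxes.WindowExtinction.FreeVolumeHeavyWitness

end
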